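import Mathlib.Tactic
import HarnessLib

/-!
# Kozma–Nitzan's Question 8 — UNI-C(U;y) with prefix A-defects: THEOREM C-Ỹ and the prefix A-loss lemma (gen 41)

Support file (`--supports stmt-CriticalPhenomena-4575`, closed crux; independent mathematics on Kozma–Nitzan's Question 8,
arXiv:2401.12397 §5.5 p. 36), prover `prim-ineq-gen-6` (gen 41).  No definitions, no named facts, no sorries; standard axioms.
Memo `run/shared/lean/prim/prim-ineq-gen-6/FINDING-G41.md` §3 (the reduction that removes the PRE supply-loss term of THEOREM C-STAR /
THEOREM C-Y for blocks whose positive region carries A-defects).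

* `kPre_layercake` — the general layer cake: with `H⁺ = Σ_{k≤i} e_k/a_k ≥ Q₊/a_0` (since `a_k ≤ a_0`), `a_{v−1}Ñ_{v−1} ≤ N_{v−1}` (since
  `a_{v−1} ≤ a_l`) and the C-hypothesis `N_{v−1} ≤ Q₊`:  `a_{v−1}Hs_{v−1} = a_{v−1}(H⁺ − Ñ_{v−1}) ≥ −(1 − a_{v−1}/a_0)·N_{v−1}` — THEOREM C-Y holds verbatim
  for every block with the A-death measured from the root (`α̃_{v−1} = 1 − A_[1,v−1]`) and NO PRE term (THEOREM C-Ỹ);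
* `kPre_fat` — the need rewriting `A_[v,t]·α̃_{v−1} = a_t·(1/a_{v−1} − 1/a_0)`;
* `kPre_PA` — the prefix A-loss lemma: at a positive depth (`Ũ_j < 0`) with `Ũ = uL̃ + vR̃ − Γuv`, `L̃ ≥ 0`, `R̃ ≥ γ[(1−a)K + aK₄]`,
  `Γ = γa²Z` (`Z = ΦS_{j+1}`):  `(1−a_j)(K₃ − H_{j−1}) + a_jK₄ < a_j²ΦS_{j+1}u_{j+1}` — the A-loss up to any positive depth is controlled by the
  A-view beyond it (exact checks lab-g41/g41/p01_prefix.py, ratio ≤ 0.996 in climbs: sharp).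
[cite: KozmaNitzan2024, Question 8 (§5.5 p. 36)]
-/

namespace Summit.CriticalPhenomena.PercolationContinuityZ3.Theorems

namespace PocketCert

/-- **General layer cake (THEOREM C-Ỹ).**  If `a₀ > 0`, `0 ≤ a` (in the block `a = a_{v−1} ≤ a₀`), `H ≥ Q/a₀` (positive cumulative emission, `a_k ≤ a₀`), `a·Ñ ≤ N`
(the kills after `k₁`, `a_{v−1} ≤ a_l`) and `N ≤ Q` (the C-hypothesis), then `a·(H − Ñ) ≥ −(1 − a/a₀)·N`: the plain cumulative emission in
front of a C-defect is bounded below by minus the TOTAL A-death since the root times the kill sum — no PRE supply loss.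
[cite: KozmaNitzan2024, Question 8 (§5.5 p. 36)] -/
theorem kPre_layercake (a a₀ H Nt N Q : ℝ) (ha₀ : 0 < a₀) (ha0 : 0 ≤ a) (hH : Q / a₀ ≤ H)
    (hNt : a * Nt ≤ N) (hNQ : N ≤ Q) : -(1 - a / a₀) * N ≤ a * (H - Nt) := by
  have h1 : a * (Q / a₀) ≤ a * H := mul_le_mul_of_nonneg_left hH ha0
  have h2 : a / a₀ * N ≤ a * (Q / a₀) := by
    rw [div_mul_eq_mul_div, mul_div_assoc]
    exact mul_le_mul_of_nonneg_left (div_le_div_of_nonneg_right hNQ ha₀.le) ha0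
  nlinarith

/-- **Need rewriting.**  With `a_t = a_{v−1}·A` (`A = A_[v,t]`) and `a_{v−1}, a₀ ≠ 0`:  `A·(1 − a_{v−1}/a₀) = a_t·(1/a_{v−1} − 1/a₀)`, i.e. the
need coefficient of THEOREM C-Ỹ is `γ_{v−1}·a_t·fã_{v−1}` with `fã_{v−1} := 1/a_{v−1} − 1/a₀` (A-death after the root in `1/a` units).
[cite: KozmaNitzan2024, Question 8 (§5.5 p. 36)] -/
theorem kPre_fat (av a₀ A aT : ℝ) (hav : av ≠ 0) (haT : aT = av * A) :
    A * (1 - av / a₀) = aT * (1 / av - 1 / a₀) := by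
  subst haT; field_simp

/-- **Prefix A-loss lemma (PA).**  At a positive depth the U-identity value is negative: `u·L̃ + v·R̃ − Γ·u·v < 0` with `u, v, L̃ ≥ 0`,
`R̃ ≥ γ[(1−a)K + aK₄]`, `Γ = γ·a²·Z` and `γ > 0`.  Then `(1−a)K + aK₄ < a²·Z·u`: in the block, `(1−a_j)(K₃−H_{j−1}) + a_jK₄ < a_j²ΦS_{j+1}u_{j+1}`,
so the total A-loss up to the last positive depth is `< a_i²ΦS·u_{k₁}/(K₃ − H_{i−1})`.
[cite: KozmaNitzan2024, Question 8 (§5.5 p. 36)] -/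
theorem kPre_PA (u v L R Γ γ a K K4 Z : ℝ) (hneg : u * L + v * R - Γ * u * v < 0) (hu : 0 ≤ u) (hv : 0 ≤ v) (hL : 0 ≤ L)
    (hR : γ * ((1 - a) * K + a * K4) ≤ R) (hΓ : Γ = γ * a ^ 2 * Z) (hγ : 0 < γ) :
    (1 - a) * K + a * K4 < a ^ 2 * Z * u := by
  have huL : 0 ≤ u * L := mul_nonneg hu hL
  have h1 : v * (R - Γ * u) < 0 := by nlinarith
  have hvpos : 0 < v := by
    rcases lt_or_eq_of_le hv with h | h
    · exact h
    · exfalso; rw [← h] at h1; simp at h1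
  have h2 : R - Γ * u < 0 := by
    by_contra h; push Not at h
    have := mul_nonneg hvpos.le h
    linarith
  have h3 : γ * ((1 - a) * K + a * K4) < γ * (a ^ 2 * Z * u) := by
    calc γ * ((1 - a) * K + a * K4) ≤ R := hR
      _ < Γ * u := by linarith
      _ = γ * (a ^ 2 * Z * u) := by rw [hΓ]; ring
  exact lt_of_mul_lt_mul_left h3 hγ.le

end PocketCert

end Summit.CriticalPhenomena.PercolationContinuityZ3.Theorems
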